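import Literature.AlgebraicGeometry.Motives.ZarhinHodgeGroupLieAlgebra
import HarnessLib

/-!
# The Lie algebra of the Hodge group is non-zero off type `(p,p)`, and non-abelian when no Hodge endomorphism is skew

Pure Hodge structures `H` of weight `n` on a finite-dimensional `ℚ`-space `V` (the tree's
`Motives.HodgeStructure`, with `hodgeLie H = Lie Hdg(H) ⊆ End_ℚ(V)` and its complexification
`hodgeLieC H` of `Motives/ZarhinHodgeGroupLieAlgebra`). Two elementary structural facts, proved:

* `hodgeLie_ne_bot` — if some `V^{p, n-p} ≠ 0` with `2p ≠ n`, then `Lie Hdg(H) ≠ 0`: the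
  infinitesimal Hodge operator `Θ` (`= 2p - n` on `V^{p,n-p}`, the tree's `exists_hodgeTheta`) lies
  in `hodgeLieC H = (Lie Hdg) ⊗ ℂ` (`mem_hodgeLieC_of_forall_piece`) and is non-zero there
  (Deligne, LNM 900, I §3: `μ(𝔾_m) ⊆ MT`, so `Hg` is trivial only in type `(p,p)`).
* `exists_commutator_ne_zero_of_forall_skew_eq_zero` — if moreover `H` carries a polarization `ψ`
  for which NO non-zero Hodge endomorphism is `ψ`-skew (`ψ(av, w) + ψ(v, aw) = 0 ⟹ a = 0`; e.g.
  `End_Hdg(V) = E` a totally real field on which the Rosati involution is the identity — type I),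
  then `Lie Hdg(H)` is NOT commutative. Proof: were it commutative, each `X ∈ Lie Hdg` would commute
  with `Lie Hdg`, hence be a Hodge endomorphism (the tree's commutant theorem
  `mem_endAlg_of_forall_commute`: `Θ ∈ hodgeLieC` has the Hodge pieces as eigenspaces), and `X` is
  `ψ`-skew (`form_apply_add_eq_zero_of_mem_hodgeLie`: `ψ` is a Hodge tensor), so `X = 0` — but
  `Lie Hdg ≠ 0`.

Use (cell `pub-hodge-ring2`, Literature lane, real-multiplication programme R2a): hypothesis (a)
"the hull is non-abelian" of `RepresentationTheory/GeneralLinear/Sl2PlacesRationalHull`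
(`single_sl2_mem_span_places_image`, `eq_traceZero_of_places`) for the Hodge structure `H¹(X)` of an
abelian variety with `End⁰(X) = E` totally real (Hazama 1983 §3: `Hg = R_{E/ℚ} SL₂`). Research
context: a route conditional on HC_CM; this file is unconditional Hodge–Lie linear algebra and no
step towards a summit statement. No definition, no named fact (D-0026); axioms standard.

## References

* [Deligne1982HodgeCycles] P. Deligne, *Hodge cycles on abelian varieties*, LNM 900 (1982), I §3
  (3.1–3.4: `h`, `μ`, the Mumford–Tate group and its Lie algebra). [cite: Deligne1982HodgeCycles, I §3]
* [Huybrechts2016K3] D. Huybrechts, *Lectures on K3 Surfaces* (CUP 2016), §3.3.4 (p. 66) and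
  Thm. 3.3.9 (proof, p. 67: `Hdg` commutes with `End_Hdg`, `Hdg ⊆ SO(ψ)`). [cite: Huybrechts2016K3, §3.3.4 and Thm. 3.3.9]
* [Hazama1983] F. Hazama, Tôhoku Math. J. 35 (1983) 303–308, §3 (the application). [cite: Hazama1983, §3]
-/

noncomputable section

open scoped TensorProduct

namespace Literature.AlgebraicGeometry.Motives

namespace HodgeStructure

universe u

variable {V : Type u} [AddCommGroup V] [Module ℚ V] [Module.Finite ℚ V] [HodgeTensorFacts.{u, u}]
  {n : ℤ}

/-- `Lie Hdg = 0 ⟹ (Lie Hdg) ⊗ ℂ = 0` (the complexification is the span of the base changes;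
`Lie(Hdg) ⊗ ℂ = Lie(Hdg_ℂ)`, Huybrechts §3.3.4). [cite: Huybrechts2016K3, §3.3.4 (p. 66)] -/
private theorem hodgeLieC_eq_bot_of_hodgeLie_eq_bot (H : HodgeStructure V n) (h : H.hodgeLie = ⊥) :
    H.hodgeLieC = ⊥ := by
  unfold hodgeLieC
  rw [h, Submodule.span_eq_bot]
  rintro _ ⟨X, hX, rfl⟩
  rw [SetLike.mem_coe, Submodule.mem_bot] at hX
  subst hX
  exact LinearMap.baseChange_zero

/-- **`Lie Hdg(H) ≠ 0` as soon as some `V^{p,n-p} ≠ 0` with `2p ≠ n`**: the Hodge operator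
`Θ = 2p - n` on `V^{p,n-p}` lies in `(Lie Hdg) ⊗ ℂ` and does not vanish there (Deligne I §3:
`Hg(H)` is trivial exactly in type `(p,p)`). [cite: Deligne1982HodgeCycles, I §3 (3.1–3.4)]
[cite: Huybrechts2016K3, §3.3.4 (p. 66)] -/
theorem hodgeLie_ne_bot (H : HodgeStructure V n) {p : ℤ} (hp : 2 * p ≠ n)
    (hpiece : H.piece p (n - p) ≠ ⊥) : H.hodgeLie ≠ ⊥ := by
  intro h
  obtain ⟨Θ, hΘ⟩ := exists_hodgeTheta H
  have hΘmem : Θ ∈ H.hodgeLieC := H.mem_hodgeLieC_of_forall_piece hΘ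
  rw [H.hodgeLieC_eq_bot_of_hodgeLie_eq_bot h, Submodule.mem_bot] at hΘmem
  obtain ⟨x, hx, hx0⟩ := Submodule.exists_mem_ne_zero_of_ne_bot hpiece
  have hΘx := hΘ p x hx
  rw [hΘmem, LinearMap.zero_apply] at hΘx
  have hc : ((2 * p - n : ℤ) : ℂ) ≠ 0 := by exact_mod_cast sub_ne_zero.2 hp
  exact hx0 ((smul_eq_zero.1 hΘx.symm).resolve_left hc)

/-- **`Lie Hdg(H)` is non-abelian when no non-zero Hodge endomorphism is `ψ`-skew** (and some
`V^{p,n-p} ≠ 0`, `2p ≠ n`). If all elements of `Lie Hdg` commuted, every `X ∈ Lie Hdg` would be a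
Hodge endomorphism (commutant theorem) which is `ψ`-skew (`Hdg ⊆ Sp/SO(ψ)`), hence `0`; but
`Lie Hdg ≠ 0`. For `H = H¹(X)`, `X` an abelian variety with `End⁰(X) = E` a totally real field
(Rosati trivial on `E`), this is "the Hodge Lie algebra of `X` is not commutative" — hypothesis (a)
of `Sl2PlacesRationalHull`. [cite: Huybrechts2016K3, Thm. 3.3.9 (proof, p. 67)]
[cite: Deligne1982HodgeCycles, I §3] [cite: Hazama1983, §3] -/
theorem exists_commutator_ne_zero_of_forall_skew_eq_zero (H : HodgeStructure V n)
    (ψ : H.Polarization)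
    (hskew : ∀ a : H.endAlg,
      (∀ v w : V, ψ.form ((a : Module.End ℚ V) v) w + ψ.form v ((a : Module.End ℚ V) w) = 0) →
        (a : Module.End ℚ V) = 0)
    {p : ℤ} (hp : 2 * p ≠ n) (hpiece : H.piece p (n - p) ≠ ⊥) :
    ∃ X ∈ H.hodgeLie, ∃ Y ∈ H.hodgeLie, X * Y - Y * X ≠ 0 := by
  by_contra hab
  push Not at hab
  apply H.hodgeLie_ne_bot hp hpiece
  rw [Submodule.eq_bot_iff]
  intro X hX
  have hXend : X ∈ H.endAlg :=
    H.mem_endAlg_of_forall_commute fun Z hZ => sub_eq_zero.1 (hab X hX Z hZ)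
  exact hskew ⟨X, hXend⟩ fun v w => form_apply_add_eq_zero_of_mem_hodgeLie ψ hX v w

/-- The same, packaged as "`Lie Hdg(H)` is not commutative". [cite: Huybrechts2016K3, Thm. 3.3.9 (proof, p. 67)] -/
theorem not_forall_commute_hodgeLie_of_forall_skew_eq_zero (H : HodgeStructure V n)
    (ψ : H.Polarization)
    (hskew : ∀ a : H.endAlg,
      (∀ v w : V, ψ.form ((a : Module.End ℚ V) v) w + ψ.form v ((a : Module.End ℚ V) w) = 0) →
        (a : Module.End ℚ V) = 0)
    {p : ℤ} (hp : 2 * p ≠ n) (hpiece : H.piece p (n - p) ≠ ⊥) :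
    ¬ ∀ X ∈ H.hodgeLie, ∀ Y ∈ H.hodgeLie, X * Y = Y * X := by
  intro h
  obtain ⟨X, hX, Y, hY, hne⟩ := H.exists_commutator_ne_zero_of_forall_skew_eq_zero ψ hskew hp hpiece
  exact hne (sub_eq_zero.2 (h X hX Y hY))

end HodgeStructure

end Literature.AlgebraicGeometry.Motives

end
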